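import Summits.CriticalPhenomena.SAWScalingLimit.Theorems.SAWDevelopingMapHexConjectureArchTailSummed
import Literature.Probability.RandomPlanarGeometry.HexSAWTriangle
import HarnessLib

/-!
# Crux `HexConjecture` (stmt-CriticalPhenomena-0808), line `root-locality-replaces-loewner`:
the Glazman–Manolescu triangle arch mass `A^Δ(L)` as floor arch masses of the chart preimage

Landing target:
`Summits/CriticalPhenomena/SAWScalingLimit/Theorems/SAWDevelopingMapHexConjectureTriangleArchTransfer.lean`
(`--supports stmt-CriticalPhenomena-0808`; stub `stub_triA_le_sum_archMass_triChart` of the lead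
continuation prover-line-stmt-CriticalPhenomena-0808-c8-0).

The far side of the line's lever (the arch aspect bound) is the `x_c`-mass of half-plane arches
`s_x → t_d` leaving radius `R`; the lead bounds it by `1/cos(3π/8) − A^Δ(L)` through the
Glazman–Manolescu triangle identity `cos(3π/8)·A^Δ(L) + cos(π/8)·D^Δ(L) = 1` (`HV.tri_identity`,
`HexSAWTriangle.lean`), following the template of `farArchMass_offsetSum_le`
(`…HexConjectureArchTailSummed.lean`) with the chart preimage
`T_x(L) := (HV.triV L).map Φ_x⁻¹` of the triangle `T_L` (`Φ_x := hvIso.trans (shift (-x₀) (-x₁))`,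
the standard chart at the root cell `x`) in place of the inner half-strip.  This file is the
TRANSFER step:

* `triArch_floorUp_mem_chart`: the up-faces `(y, 0)` of the floor cells `y` of the row `x₁` with
  `|y₀ - x₀| ≤ L` lie in the chart preimage `T_x(L)` (`Finset.mem_map_equiv`; the geometry of
  `T_x(L)` is in the sibling file `…HexConjectureTriangleChart.lean`);
* `triArch_archMass_chart_eq` / `triArch_archMass_offset_eq` (translation invariance, copy of
  `archMass_halfStrip_eq`): the critical floor arch mass `Z_{T_x(L)}(s_x → t_{x + d e₀})`,
  `|d| ≤ L`, is the sum of `x_c^ℓ` over the coded mid-edge walks of `T_L` whose final dart lies on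
  the floor mid-edge at abscissa `d` (`archMass_eq_sum_midWalks`);
* `triArch_alphaDart_abscissa`: an `α`-walk of `T_L` (a walk from `a` leaving through the base)
  exits DOWN from a base vertex `(d, 0, false)` with `d ≠ 0` and `|d| ≤ L` (the last inner vertex
  lies in `T_L`; `d = 0` would force the walk `[w, O, w]`, which retraces `a`);
* **`triArch_triA_le_sum_archMass`** (registered as `stub_triA_le_sum_archMass_triChart`):
  `A^Δ(L) = HV.triA L ≤ Σ_{0 < |d| ≤ L} Z_{T_x(L)}(s_x → t_{x + d e₀})` — the `α`-walks of `T_L`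
  form a sub-family of the disjoint union over `d` of the coded families (`Finset.sum_biUnion`,
  `Finset.sum_le_sum_of_subset_of_nonneg`); in fact equality holds, only `≤` is consumed.
-/

noncomputable section

open scoped BigOperators Topology Classical
open Literature.Probability.LatticeModels (HexVertex hexGraph hexCenter Site)
open Literature.Probability.RandomPlanarGeometry Literature.Probability.RandomPlanarGeometry.SAW
  Literature.Probability.RandomPlanarGeometry.SAW.HV
open Summit.CriticalPhenomena.SAWScalingLimit.Theorems.ObservableToSLE.FloorRatio

namespace Summit.CriticalPhenomena.SAWScalingLimit.Theorems.HexConjecture.RootLocality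

/-! ### The chart preimage `T_x(L)` of the triangle `T_L` -/

/-- The up-face `(y, 0)` of a floor cell `y` of the row `x₁` with `-L ≤ y₀ - x₀ ≤ L` lies in
`T_x(L)` (its chart image is the base vertex `(y₀ - x₀, 0, false)` of `T_L`).
[cite: GlazmanManolescu2019, §4.1 (A^Δ)] -/
theorem triArch_floorUp_mem_chart {x y : Site 2} {L : ℕ} (hy : y 1 = x 1)
    (hd : -(L : ℤ) ≤ y 0 - x 0 ∧ y 0 - x 0 ≤ L) :
    (y, (0 : Fin 2)) ∈ (triV L).map
      (hvIso.trans (shift (-(x 0)) (-(x 1)))).symm.toEquiv.toEmbedding := by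
  rw [Finset.mem_map_equiv]
  change (hvIso.trans (shift (-(x 0)) (-(x 1)))) (y, 0) ∈ triV L
  rw [floorChart_apply, mem_triV_iff, hy, sub_self]
  simp only [Fin.isValue, zero_ne_one, decide_false, bit_false, add_zero, le_refl, true_and]
  omega

/-! ### Translation invariance of the floor arch masses of `T_x(L)` -/

/-- **`Z_{T_x(L)}(s_x, t_y)` as a coded sum.**  For `y₁ = x₁` and `(y, 0) ∈ T_x(L)` the critical
mass of the arches `s_x → t_y` inside `T_x(L)` is the sum of `x_c^ℓ` over the coded mid-edge walks
of `T_L` whose final dart lies on the floor mid-edge at abscissa `y₀ - x₀` (the coding bijection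
`archMass_eq_sum_midWalks` at the standard chart, as in `archMass_halfStrip_eq`).
[cite: DuminilCopinSmirnov2012, §1–§2 (walks between mid-edges)] -/
theorem triArch_archMass_chart_eq (x y : Site 2) (L : ℕ) (hy : y 1 = x 1)
    (hy0 : (y, (0 : Fin 2)) ∈ (triV L).map
      (hvIso.trans (shift (-(x 0)) (-(x 1)))).symm.toEquiv.toEmbedding) :
    ∑ γ : HexMidEdgeSAW ((triV L).map
        (hvIso.trans (shift (-(x 0)) (-(x 1)))).symm.toEquiv.toEmbedding)
        s((x - Pi.single 1 1, 1), (x, 0)) s((y - Pi.single 1 1, 1), (y, 0)),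
        hexCriticalFugacity ^ γ.length =
      ∑ P ∈ (midWalks (triV L)).filter
          (fun P => finalDart P = ((y 0 - x 0, 0, false), (y 0 - x 0, -1, true)) ∨
            finalDart P = ((y 0 - x 0, -1, true), (y 0 - x 0, 0, false))),
        hexCriticalFugacity ^ mwLen P := by
  set Φ : hexGraph ≃g hvGraph := hvIso.trans (shift (-(x 0)) (-(x 1))) with hΦ
  set Λ := (triV L).map Φ.symm.toEquiv.toEmbedding with hΛ
  have hmap : Λ.map Φ.toEquiv.toEmbedding = triV L := by
    ext v
    rw [hΛ, Finset.mem_map_equiv, Finset.mem_map_equiv]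
    exact iff_of_eq (congrArg (· ∈ _) (Φ.apply_symm_apply v))
  have hx0 : (x, (0 : Fin 2)) ∈ Λ := by
    rw [hΛ, Finset.mem_map_equiv]
    change Φ (x, 0) ∈ triV L
    rw [hΦ, floorChart_up]
    exact hvOrigin_mem_triV L
  have hu : (x - Pi.single 1 1, (1 : Fin 2)) ∉ Λ := by
    rw [hΛ, Finset.mem_map_equiv]
    change Φ (x - Pi.single 1 1, 1) ∉ triV L
    rw [hΦ, floorChart_down]
    intro h
    have := (mem_triV_iff.1 h).1
    simp [wOut] at this
  have hΦy : Φ (y, 0) = (y 0 - x 0, 0, false) := by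
    rw [hΦ, floorChart_apply, hy, sub_self]
    rfl
  have hΦy' : Φ (y - Pi.single 1 1, 1) = (y 0 - x 0, -1, true) := by
    rw [hΦ, floorChart_apply]
    simp only [Pi.sub_apply, Pi.single_eq_same, Fin.isValue, decide_true]
    refine Prod.ext ?_ (Prod.ext ?_ rfl)
    · simp
    · show y 1 - 1 - x 1 = -1
      omega
  have e : s((y - Pi.single 1 1, (1 : Fin 2)), (y, (0 : Fin 2))) =
      s((y, (0 : Fin 2)), (y - Pi.single 1 1, (1 : Fin 2))) := Sym2.eq_swap
  rw [e, archMass_eq_sum_midWalks rfl hu hx0 (adj_floorEdge x) (hΦ ▸ floorChart_down x)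
    (hΦ ▸ floorChart_up x) (adj_floorEdge y).symm hy0, hmap, hΦy, hΦy']

/-- **The floor arch mass of `T_x(L)` at offset `d` is the coded triangle sum.**  For `|d| ≤ L`
the critical mass of the arches `s_x → t_{x + d e₀}` inside `T_x(L)` is the sum of `x_c^ℓ` over
the coded mid-edge walks of `T_L` ending on the floor mid-edge at abscissa `d`; in particular it
does not depend on `x`. [cite: DuminilCopinSmirnov2012, §1–§2 (walks between mid-edges)] -/
theorem triArch_archMass_offset_eq (x : Site 2) (L : ℕ) (d : ℤ)
    (hd : -(L : ℤ) ≤ d ∧ d ≤ L) :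
    ∑ γ : HexMidEdgeSAW ((triV L).map
        (hvIso.trans (shift (-(x 0)) (-(x 1)))).symm.toEquiv.toEmbedding)
        s((x - Pi.single 1 1, 1), (x, 0))
        s((x + Pi.single 0 d - Pi.single 1 1, 1), (x + Pi.single 0 d, 0)),
        hexCriticalFugacity ^ γ.length =
      ∑ P ∈ (midWalks (triV L)).filter
          (fun P => finalDart P = ((d, 0, false), (d, -1, true)) ∨
            finalDart P = ((d, -1, true), (d, 0, false))),
        hexCriticalFugacity ^ mwLen P := by
  have hy1 : (x + Pi.single 0 d : Site 2) 1 = x 1 := offsetCell_apply_one x d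
  have hd' : (x + Pi.single 0 d : Site 2) 0 - x 0 = d := offsetCell_sub x d
  set y : Site 2 := x + Pi.single 0 d with hydef
  clear_value y
  subst hd'
  exact triArch_archMass_chart_eq x y L hy1 (triArch_floorUp_mem_chart hy1 hd)

/-! ### The `α`-walks of the triangle exit at a non-zero abscissa `|d| ≤ L` -/

/-- **Anatomy of an `α`-walk of `T_L`.**  If a mid-edge walk `P` of `T_L` from `a` has a final
dart of class `α` (it leaves through the base), then the dart goes from the base vertex
`(d, 0, false)` down to `(d, -1, true)` with `d ≠ 0` and `-L ≤ d ≤ L`: the source of the dart is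
the last inner vertex, a vertex of `T_L`; and `d = 0` would make the last inner vertex the first
one, `O`, so that `P = [w, O, w]` retraces `a` — excluded ("the only walk from `a` to `a` is the
trivial one", which is not an `α`-walk). [cite: GlazmanManolescu2019, §4.1 (A^Δ)] -/
theorem triArch_alphaDart_abscissa {L : ℕ} {P : List HV} (hP : IsMidWalk (triV L) P)
    (hα : IsAlphaDart (finalDart P)) :
    (finalDart P).1.1 ≠ 0 ∧ -(L : ℤ) ≤ (finalDart P).1.1 ∧ (finalDart P).1.1 ≤ L ∧
      finalDart P = (((finalDart P).1.1, 0, false), ((finalDart P).1.1, -1, true)) := by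
  rcases hP.trivial_or_exists with rfl | ⟨l, u, hl, rfl⟩
  · exact absurd hα.1 (by simp [finalDart, wOut])
  rw [finalDart_cons_append hl] at hα ⊢
  obtain ⟨h1, h2, h3⟩ := hα
  dsimp only at h1 h2 h3 ⊢
  obtain ⟨-, hhead, -, hlV, hnd, hne⟩ := (isMidWalk_cons_append_iff _ hl u).1 hP
  have hv := mem_triV_iff.1 (hlV _ (List.getLast_mem hl))
  have hb : bit (l.getLast hl) = 0 := by simp [bit, h2]
  refine ⟨?_, hv.2.1, by omega, Prod.ext (Prod.ext rfl (Prod.ext h1 h2)) h3⟩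
  intro h0
  have hlast : l.getLast hl = hvOrigin := Prod.ext h0 (Prod.ext h1 h2)
  obtain ⟨a, l', rfl⟩ := List.exists_cons_of_ne_nil hl
  simp only [List.head?_cons, Option.some.injEq] at hhead
  subst hhead
  have hl' : l' = [] := by
    by_contra hne'
    rw [List.getLast_cons hne'] at hlast
    exact (List.nodup_cons.1 hnd).1 (hlast ▸ List.getLast_mem hne')
  subst hl'
  apply hne
  rw [h3, hlast]
  rfl

/-! ### The transfer inequality -/

/-- **`A^Δ(L) ≤ Σ_{0 < |d| ≤ L} Z_{T_x(L)}(s_x → t_{x + d e₀})`.**  The Glazman–Manolescu arch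
partition function of the triangle `T_L` (walks from `a` inside `T_L` leaving through the base,
weight `x_c^ℓ`) is at most — in fact equal to — the sum over the non-zero offsets `d ∈ [-L, L]` of
the critical floor arch masses `s_x → t_{x + d e₀}` of the chart preimage `T_x(L)` at any root cell
`x`: by `triArch_archMass_offset_eq` each floor arch mass is the coded sum over the walks of `T_L`
ending on the floor mid-edge at abscissa `d`, these coded families are pairwise disjoint, and by
`triArch_alphaDart_abscissa` every `α`-walk belongs to one of them.
[cite: GlazmanManolescu2019, §4.1 (A^Δ)] -/
theorem triArch_triA_le_sum_archMass (x : Site 2) (L : ℕ) :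
    triA L ≤ ∑ d ∈ (Finset.Icc (-(L : ℤ)) (L : ℤ)).erase 0,
      ∑ γ : HexMidEdgeSAW ((triV L).map
          (hvIso.trans (shift (-(x 0)) (-(x 1)))).symm.toEquiv.toEmbedding)
        s((x - Pi.single 1 1, 1), (x, 0))
        s((x + Pi.single 0 d - Pi.single 1 1, 1), (x + Pi.single 0 d, 0)),
        hexCriticalFugacity ^ γ.length := by
  set D := (Finset.Icc (-(L : ℤ)) (L : ℤ)).erase 0 with hD
  set F : ℤ → Finset (List HV) := fun d => (midWalks (triV L)).filter
      (fun P => finalDart P = ((d, 0, false), (d, -1, true)) ∨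
        finalDart P = ((d, -1, true), (d, 0, false))) with hF
  have hmemD : ∀ {d : ℤ}, d ∈ D ↔ d ≠ 0 ∧ -(L : ℤ) ≤ d ∧ d ≤ L := by
    intro d
    rw [hD, Finset.mem_erase, Finset.mem_Icc]
  -- every floor arch mass is a coded triangle sum
  have hterm : ∀ d ∈ D, ∑ γ : HexMidEdgeSAW ((triV L).map
        (hvIso.trans (shift (-(x 0)) (-(x 1)))).symm.toEquiv.toEmbedding)
      s((x - Pi.single 1 1, 1), (x, 0))
      s((x + Pi.single 0 d - Pi.single 1 1, 1), (x + Pi.single 0 d, 0)),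
      hexCriticalFugacity ^ γ.length = ∑ P ∈ F d, hexCriticalFugacity ^ mwLen P :=
    fun d hd => triArch_archMass_offset_eq x L d (hmemD.1 hd).2
  rw [Finset.sum_congr rfl hterm]
  -- the coded families are pairwise disjoint (the final dart determines the abscissa)
  have hdisj : (D : Set ℤ).PairwiseDisjoint F := by
    intro d _ d' _ hne
    rw [Function.onFun, Finset.disjoint_left]
    intro P hP hP'
    apply hne
    obtain ⟨-, h⟩ := Finset.mem_filter.1 hP
    obtain ⟨-, h'⟩ := Finset.mem_filter.1 hP'
    have e1 : (finalDart P).1.1 = d := by rcases h with h | h <;> rw [h]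
    have e2 : (finalDart P).1.1 = d' := by rcases h' with h' | h' <;> rw [h']
    exact e1.symm.trans e2
  rw [← Finset.sum_biUnion hdisj]
  -- the `α`-walks form a sub-family of the union
  unfold triA
  refine Finset.sum_le_sum_of_subset_of_nonneg (fun P hP => ?_)
    fun _ _ _ => pow_nonneg hexCriticalFugacity_pos_lt_one.1.le _
  obtain ⟨hPm, hα⟩ := Finset.mem_filter.1 hP
  obtain ⟨h0, hlo, hhi, hfd⟩ := triArch_alphaDart_abscissa (mem_midWalks_iff.1 hPm) hα
  exact Finset.mem_biUnion.2 ⟨(finalDart P).1.1, hmemD.2 ⟨h0, hlo, hhi⟩,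
    Finset.mem_filter.2 ⟨hPm, Or.inl hfd⟩⟩

/-- **Registered sub-goal `stub_triA_le_sum_archMass_triChart`** (crux item
stmt-CriticalPhenomena-0808, line `root-locality-replaces-loewner`, seat c8): the
Glazman–Manolescu triangle arch mass `A^Δ(L) = HV.triA L` is at most the sum over the non-zero
offsets `d ∈ [-L, L]` of the critical floor arch masses `Z_{T_x(L)}(s_x → t_{x + d e₀})` of the
chart preimage `T_x(L)` of the triangle at the root cell `x` (`triArch_triA_le_sum_archMass`).
[cite: GlazmanManolescu2019, §4.1 (A^Δ)] -/
theorem stub_triA_le_sum_archMass_triChart :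
    ∀ (x : Literature.Probability.LatticeModels.Site 2) (L : ℕ),
    Literature.Probability.RandomPlanarGeometry.SAW.HV.triA L ≤
      ∑ d ∈ (Finset.Icc (-(L : ℤ)) (L : ℤ)).erase 0,
        ∑ γ : Literature.Probability.RandomPlanarGeometry.SAW.HexMidEdgeSAW
          ((Literature.Probability.RandomPlanarGeometry.SAW.HV.triV L).map
            ((Literature.Probability.RandomPlanarGeometry.SAW.hvIso.trans
              (Literature.Probability.RandomPlanarGeometry.SAW.HV.shift (-(x 0)) (-(x 1)))).symm.toEquiv.toEmbedding))
          s((x - Pi.single 1 1, 1), (x, 0))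
          s((x + Pi.single 0 d - Pi.single 1 1, 1), (x + Pi.single 0 d, 0)),
          Literature.Probability.RandomPlanarGeometry.SAW.hexCriticalFugacity ^ γ.length :=
  fun x L => triArch_triA_le_sum_archMass x L

end Summit.CriticalPhenomena.SAWScalingLimit.Theorems.HexConjecture.RootLocality

end
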